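import Literature.NumberTheory.EllipticCurves.PadicSeriesEvaluation
import Literature.NumberTheory.EllipticCurves.PAdicHeightsLogProofs
import Mathlib.RingTheory.PowerSeries.Derivative
import Mathlib.Topology.Algebra.InfiniteSum.Nonarchimedean
import HarnessLib

/-!
# The Iwasawa logarithm of the value of an integral power series is the value of its formal
# logarithm: `log_p F(u) = (flog F)(u)` (proofs only)

Topic `Literature/NumberTheory/EllipticCurves` (trunk T-NT-EC); PROOFS file (theorems only: no
definition, no named fact, no instance). Sequel of `PadicSeriesEvaluation.lean` (`padicEval`,
`IsPadicInt`) and `PAdicHeightsLogProofs.lean` (the Iwasawa logarithm `padicLog` and its logarithmic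
series, `hasSum_padicLog_holds`). Written by the width seat `bsd-line-cf2-p1-w8` (g26) of the BSD
cell `bsd-print-cf2`, as the analytic lemma behind the comparison of the cyclotomic `p`-adic height
over a number field with the minus-twist receptacle (`CanonicalPAdicHeightCyc.lean`, the series
`ℒ_p = padicLogSigmaSqShift = log(Σ_p/t²)` defined through `dℒ = dS/S`). Nothing about elliptic
curves is used or proved here.

## Result

For `F ∈ 1 + X ℤ_p⟦X⟧` (`IsPadicInt F`, `F(0) = 1`) and its FORMAL LOGARITHM `G` — the series with
`G(0) = 0` and `dG · F = dF` (so `G = log F`; over `ℚ_p` it is `Σ_{k ≥ 1} (−1)^{k+1}(F − 1)^k/k`) — and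
every `u ∈ ℚ_p` with `‖u‖ < 1`:

* `hasSum_coeff_formalLog_mul_pow` — `Σ_n [Xⁿ]G · uⁿ` converges to `log_p (F(u))`
  (`F(u) = padicEval F u`, `log_p = padicLog`, the Iwasawa logarithm);
* `padicLog_padicEval` — `log_p (padicEval F u) = padicEval G u`.

## Method

The Mercator series `Λ = Σ_{k≥1} (−1)^{k+1} X^k / k` has `‖[X^k]Λ‖ ≤ k`, `dΛ · (1 + X) = 1`, and sums
to `log_p(1 + v)` on `‖v‖ < 1` (`hasSum_padicLog_holds`). With `A = F − 1` (integral, no constant term),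
`Λ ∘ A` has derivative `(dΛ ∘ A)·dA = dF/F`, so `Λ ∘ A = G` (`PowerSeries.derivative.ext`); and the
coefficients of `Λ ∘ A` are FINITE sums `[Xⁿ](Λ∘A) = Σ_{k ≤ n} [X^k]Λ · [Xⁿ]A^k` whose double family
`(k, n) ↦ [X^k]Λ · [Xⁿ]A^k · uⁿ` is summable in `ℚ_p` (terms bounded by `n‖u‖ⁿ → 0`, nonarchimedean
summability) — the one-variable twin of `hasSum_padicEval₂_powerSeries_subst`
(`FormalGroupPadicLogPointProofs.lean`, AEC IV.6.4(a)) — so summing by rows and by columns gives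
`Σ_n [Xⁿ]G uⁿ = Σ_k [X^k]Λ · A(u)^k = log_p(1 + A(u)) = log_p F(u)`.

## References

* K. Iwasawa, *Lectures on p-adic L-functions* (1972), §4.4 (the logarithm and its series).
  [Iwasawa1972PadicL]
* J. H. Silverman, *The Arithmetic of Elliptic Curves*, 2nd ed. (2009), IV.6.3(a), IV.6.4(a)
  (convergence of `p`-adic series with `‖a_n‖ ≤ n`, rearrangement). [SilvermanAEC2009]
* N. Bourbaki, *Algebra II* (Chapters 4–7), IV.§4 no. 2–3 (order, substitution of formal power series). [BourbakiAlgebraII2003]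
* N. Koblitz, *p-adic Numbers, p-adic Analysis, and Zeta-Functions* (1984), IV.1–IV.2 (`log_p` as a power series). [Koblitz1984]
-/

noncomputable section

open PowerSeries Filter
open scoped Topology

namespace Literature.NumberTheory.EllipticCurves

/-! ### §1 Coefficients of a composite as finite sums -/

section Ring

variable {R : Type*} [CommRing R]

/-- `[Xⁿ](A^k) = 0` for `n < k` when `A(0) = 0` (order of a power; private plumbing — the tree's
`Ford2004.coeff_pow_eq_zero_of_lt` in the sieve corner is the same statement). [folklore] -/
private theorem coeff_pow_eq_zero_of_lt_of_constantCoeff {A : R⟦X⟧} (hA0 : constantCoeff A = 0)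
    {n k : ℕ} (h : n < k) : coeff n (A ^ k) = 0 := by
  have h1 : (1 : ℕ∞) ≤ A.order := (one_le_order_iff_constCoeff_eq_zero).mpr hA0
  have hk : ((k : ℕ) : ℕ∞) ≤ (A ^ k).order :=
    calc ((k : ℕ) : ℕ∞) = k • (1 : ℕ∞) := by simp
      _ ≤ k • A.order := nsmul_le_nsmul_right h1 k
      _ ≤ (A ^ k).order := le_order_pow A k
  exact coeff_of_lt_order n (lt_of_lt_of_le (by exact_mod_cast h) hk)

/-- **`[Xⁿ] f(A) = Σ_{k ≤ n} [X^k]f · [Xⁿ]A^k`** for `A(0) = 0` (the finite-support form of Mathlib's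
`coeff_subst'`). [cite: BourbakiAlgebraII2003, IV.§4 no. 3] -/
theorem coeff_subst_eq_sum_range_of_constantCoeff (f : R⟦X⟧) {A : R⟦X⟧}
    (hA0 : constantCoeff A = 0) (n : ℕ) :
    coeff n (f.subst A) = ∑ k ∈ Finset.range (n + 1), coeff k f * coeff n (A ^ k) := by
  rw [coeff_subst' (HasSubst.of_constantCoeff_zero' hA0),
    finsum_eq_sum_of_support_subset _ (s := Finset.range (n + 1)) ?_]
  · exact Finset.sum_congr rfl fun d _ ↦ by rw [smul_eq_mul]
  · intro d hd
    rw [Function.mem_support] at hd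
    rw [Finset.coe_range, Set.mem_Iio]
    by_contra h
    apply hd
    rw [coeff_pow_eq_zero_of_lt_of_constantCoeff hA0 (Nat.lt_of_succ_le (not_lt.mp h)),
      smul_zero]

/-- Substituting into `1` gives `1` (substitution is a ring homomorphism). [cite: BourbakiAlgebraII2003, IV.§4 no. 3] -/
theorem one_subst_of_constantCoeff {A : R⟦X⟧} (hA0 : constantCoeff A = 0) :
    (1 : R⟦X⟧).subst A = 1 := by
  rw [← coe_substAlgHom (HasSubst.of_constantCoeff_zero' hA0), map_one]

/-- `f(A)` has constant term `f(0)` when `A(0) = 0`. [cite: BourbakiAlgebraII2003, IV.§4 no. 3] -/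
theorem constantCoeff_subst_of_constantCoeff (f : R⟦X⟧) {A : R⟦X⟧} (hA0 : constantCoeff A = 0) :
    constantCoeff (f.subst A) = constantCoeff f := by
  have h := coeff_subst_eq_sum_range_of_constantCoeff f hA0 0
  rw [Finset.sum_range_one, pow_zero] at h
  simpa using h

end Ring

/-! ### §2 The one-variable Fubini lemma for an outer series with `‖[X^k]f‖ ≤ k` -/

section Fubini

variable {p : ℕ} [Fact p.Prime] {f A : ℚ_[p]⟦X⟧} {u : ℚ_[p]}

/-- **Summability of the double family** `(k, n) ↦ [X^k]f · [Xⁿ]A^k · uⁿ` for `‖[X^k]f‖ ≤ k`, `A`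
integral without constant term, `‖u‖ < 1`: the term vanishes unless `k ≤ n` and is bounded by
`n ‖u‖ⁿ → 0`; a family tending to `0` is summable in the complete nonarchimedean field `ℚ_p`.
[cite: SilvermanAEC2009, IV.6.3 and IV.6.4] -/
theorem summable_coeff_mul_coeff_pow_mul_pow (hf : ∀ k, ‖coeff k f‖ ≤ k) (hA : IsPadicInt A)
    (hA0 : constantCoeff A = 0) (hu : ‖u‖ < 1) :
    Summable fun x : ℕ × ℕ => coeff x.1 f * (coeff x.2 (A ^ x.1) * u ^ x.2) := by
  refine NonarchimedeanAddGroup.summable_of_tendsto_cofinite_zero ?_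
  set r := ‖u‖ with hr
  have hr0 : 0 ≤ r := norm_nonneg u
  -- the bound `‖term (k, n)‖ ≤ n r^n`
  have hbound : ∀ x : ℕ × ℕ,
      ‖coeff x.1 f * (coeff x.2 (A ^ x.1) * u ^ x.2)‖ ≤ (x.2 : ℝ) * r ^ x.2 := by
    rintro ⟨k, n⟩
    dsimp only
    by_cases hnk : n < k
    · rw [coeff_pow_eq_zero_of_lt_of_constantCoeff hA0 hnk, zero_mul, mul_zero, norm_zero]
      exact mul_nonneg (Nat.cast_nonneg _) (pow_nonneg hr0 _)
    · push Not at hnk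
      have b1 : ‖coeff k f‖ ≤ k := hf k
      have b2 : ‖coeff n (A ^ k)‖ ≤ 1 := isPadicInt_iff_coeff.mp (hA.pow k) n
      have b5 : (k : ℝ) ≤ n := by exact_mod_cast hnk
      rw [norm_mul, norm_mul, norm_pow]
      calc ‖coeff k f‖ * (‖coeff n (A ^ k)‖ * ‖u‖ ^ n) ≤ k * (1 * r ^ n) := by gcongr
        _ = k * r ^ n := by rw [one_mul]
        _ ≤ n * r ^ n := by gcongr
  -- `n r^n → 0`
  rw [NormedAddGroup.tendsto_nhds_zero]
  intro ε hε
  obtain ⟨N, hN⟩ : ∃ N : ℕ, ∀ m, N ≤ m → (m : ℝ) * r ^ m < ε := by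
    have h := tendsto_self_mul_const_pow_of_lt_one hr0 hu
    rw [Metric.tendsto_atTop] at h
    obtain ⟨N, hN⟩ := h ε hε
    refine ⟨N, fun m hm => ?_⟩
    have := hN m hm
    rw [Real.dist_eq, sub_zero,
      abs_of_nonneg (mul_nonneg (Nat.cast_nonneg _) (pow_nonneg hr0 _))] at this
    exact this
  -- the exceptional set is finite
  have hfin : {x : ℕ × ℕ | x.1 ≤ x.2 ∧ x.2 < N}.Finite := by
    refine ((Set.finite_Iio N).prod (Set.finite_Iio N)).subset ?_
    intro x hx
    obtain ⟨h1, h2⟩ := hx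
    simp only [Set.mem_prod, Set.mem_Iio]
    exact ⟨by omega, h2⟩
  rw [Filter.eventually_cofinite]
  refine hfin.subset fun x hx => ?_
  simp only [Set.mem_setOf_eq] at hx ⊢
  have hx' := not_lt.mp hx
  by_contra hcon
  push Not at hcon
  by_cases hnk : x.2 < x.1
  · rw [coeff_pow_eq_zero_of_lt_of_constantCoeff hA0 hnk, zero_mul, mul_zero, norm_zero] at hx'
    exact absurd hε (not_lt.mpr hx')
  · push Not at hnk
    exact absurd ((hbound x).trans_lt (hN _ (hcon hnk))) (not_lt.mpr hx')

/-- **Evaluation commutes with substitution, outer series with `‖[X^k]f‖ ≤ k`** (the Fubini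
argument of AEC IV.6.4(a), one variable): for `A ∈ Xℤ_p⟦X⟧` and `‖u‖ < 1`, the series
`Σ_n [Xⁿ](f∘A) uⁿ` converges to `f(A(u)) = Σ' [X^k]f · A(u)^k`. The one-variable twin of the tree's
`hasSum_padicEval₂_powerSeries_subst`. [cite: SilvermanAEC2009, IV.6.4] -/
theorem hasSum_coeff_subst_mul_pow (hf : ∀ k, ‖coeff k f‖ ≤ k) (hA : IsPadicInt A)
    (hA0 : constantCoeff A = 0) (hu : ‖u‖ < 1) :
    HasSum (fun n : ℕ => coeff n (f.subst A) * u ^ n) (padicEval f (padicEval A u)) := by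
  have hsum := summable_coeff_mul_coeff_pow_mul_pow hf hA hA0 hu
  -- summing over `n` first: the value is `f(A(u))`
  have h1 : HasSum (fun k : ℕ => coeff k f * (padicEval A u) ^ k)
      (∑' x : ℕ × ℕ, coeff x.1 f * (coeff x.2 (A ^ x.1) * u ^ x.2)) := by
    refine hsum.hasSum.prod_fiberwise fun k => ?_
    rw [← padicEval_pow hA hu k]
    exact (hasSum_padicEval (hA.pow k) hu).mul_left _
  have hval : padicEval f (padicEval A u) =
      ∑' x : ℕ × ℕ, coeff x.1 f * (coeff x.2 (A ^ x.1) * u ^ x.2) := by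
    have e : padicEval f (padicEval A u) = ∑' k : ℕ, coeff k f * (padicEval A u) ^ k := rfl
    rw [e]
    exact h1.tsum_eq
  -- summing over `k` first: the coefficients of `f ∘ A`
  have hsum' := (Equiv.prodComm ℕ ℕ).summable_iff.mpr hsum
  have h2 : HasSum (fun n : ℕ => coeff n (f.subst A) * u ^ n)
      (∑' y : ℕ × ℕ, coeff y.2 f * (coeff y.1 (A ^ y.2) * u ^ y.1)) := by
    refine hsum'.hasSum.prod_fiberwise fun n => ?_
    have hfin : HasSum (fun k : ℕ => coeff k f * (coeff n (A ^ k) * u ^ n))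
        (∑ k ∈ Finset.range (n + 1), coeff k f * (coeff n (A ^ k) * u ^ n)) :=
      hasSum_sum_of_ne_finset_zero fun k hk => by
        rw [Finset.mem_range, not_lt] at hk
        rw [coeff_pow_eq_zero_of_lt_of_constantCoeff hA0 (by omega), zero_mul, mul_zero]
    have hv : (∑ k ∈ Finset.range (n + 1), coeff k f * (coeff n (A ^ k) * u ^ n)) =
        coeff n (f.subst A) * u ^ n := by
      rw [coeff_subst_eq_sum_range_of_constantCoeff f hA0 n, Finset.sum_mul]
      exact Finset.sum_congr rfl fun k _ => by ring
    rw [← hv]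
    exact hfin
  rw [hval, ← (Equiv.prodComm ℕ ℕ).tsum_eq]
  exact h2

end Fubini

/-! ### §3 The Mercator series `Λ = Σ_{k≥1} (−1)^{k+1} X^k/k` -/

section Mercator

variable {p : ℕ} [Fact p.Prime] {Λ : ℚ_[p]⟦X⟧}
  (hΛ : ∀ k, coeff k Λ = if k = 0 then 0 else (-1) ^ (k + 1) / (k : ℚ_[p]))

include hΛ

/-- `‖[X^k]Λ‖ = ‖1/k‖_p ≤ k`. [cite: Iwasawa1972PadicL, §4.4] -/
theorem norm_coeff_mercator_le (k : ℕ) : ‖coeff k Λ‖ ≤ k := by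
  rw [hΛ k]
  rcases Nat.eq_zero_or_pos k with rfl | hk
  · simp
  · rw [if_neg hk.ne', norm_div, norm_pow, norm_neg, norm_one, one_pow, one_div, ← norm_inv]
    exact norm_inv_natCast_le (p := p) hk.ne'

/-- `Λ(0) = 0`. [cite: Iwasawa1972PadicL, §4.4] -/
theorem constantCoeff_mercator : constantCoeff Λ = 0 := by
  rw [← coeff_zero_eq_constantCoeff_apply, hΛ 0, if_pos rfl]

/-- `[Xⁿ] dΛ = (−1)ⁿ`, i.e. `dΛ = 1 − X + X² − ⋯`. [cite: Iwasawa1972PadicL, §4.4] -/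
theorem coeff_derivative_mercator (n : ℕ) : coeff n (d⁄dX ℚ_[p] Λ) = (-1) ^ n := by
  rw [coeff_derivative, hΛ (n + 1), if_neg (Nat.succ_ne_zero n)]
  have hn : ((n + 1 : ℕ) : ℚ_[p]) ≠ 0 := Nat.cast_ne_zero.mpr (Nat.succ_ne_zero n)
  push_cast at hn ⊢
  rw [div_mul_cancel₀ _ hn]
  ring

/-- **`dΛ · (1 + X) = 1`** (`dΛ = (1 + X)⁻¹`). [cite: Iwasawa1972PadicL, §4.4] -/
theorem derivative_mercator_mul_one_add_X : d⁄dX ℚ_[p] Λ * (1 + X) = 1 := by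
  ext n
  rw [mul_add, mul_one, map_add]
  rcases n with _ | n
  · rw [coeff_zero_mul_X, add_zero, coeff_derivative_mercator hΛ 0, pow_zero,
      coeff_zero_eq_constantCoeff, map_one]
  · rw [coeff_succ_mul_X, coeff_derivative_mercator hΛ, coeff_derivative_mercator hΛ,
      show coeff (n + 1) (1 : ℚ_[p]⟦X⟧) = 0 from by
        rw [coeff_one, if_neg (Nat.succ_ne_zero n)],
      pow_succ]
    ring

/-- **The Mercator series sums to the Iwasawa logarithm on principal units**: for `‖v‖ < 1`,
`Σ_k [X^k]Λ · v^k = log_p (1 + v)` (`hasSum_padicLog_holds`: `log_p y = −Σ_{n≥1} (1−y)ⁿ/n`).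
[cite: Iwasawa1972PadicL, §4.4, Lemma] -/
theorem hasSum_coeff_mercator_mul_pow {v : ℚ_[p]} (hv : ‖v‖ < 1) :
    HasSum (fun k : ℕ => coeff k Λ * v ^ k) (padicLog p (1 + v)) := by
  have hy : ‖(1 + v) - 1‖ < 1 := by rwa [add_sub_cancel_left]
  have hlog := hasSum_padicLog_holds p hy
  refine (hasSum_nat_add_iff' 1).mp ?_
  rw [Finset.sum_range_one, hΛ 0, if_pos rfl, zero_mul, sub_zero]
  have hfun : (fun n : ℕ => coeff (n + 1) Λ * v ^ (n + 1)) =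
      fun n : ℕ => -(1 - (1 + v)) ^ (n + 1) / (n + 1) := by
    funext n
    rw [hΛ (n + 1), if_neg (Nat.succ_ne_zero n), show (1 : ℚ_[p]) - (1 + v) = -v by ring,
      neg_pow]
    push_cast
    ring
  rw [hfun]
  exact hlog

end Mercator

/-! ### §4 `log_p F(u) = (log F)(u)` -/

section LogOfEval

variable {p : ℕ} [Fact p.Prime]

/-- **The logarithm of the value is the value of the formal logarithm.** For `F ∈ ℚ_p⟦X⟧` with
`ℤ_p`-coefficients and `F(0) = 1`, `G ∈ ℚ_p⟦X⟧` with `G(0) = 0` and `dG · F = dF` (the formal logarithm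
of `F`), and `‖u‖ < 1`: `Σ_n [Xⁿ]G · uⁿ` converges to `log_p (F(u))` (`padicLog`, `padicEval`).
[cite: Iwasawa1972PadicL, §4.4] [cite: SilvermanAEC2009, IV.6.4] -/
theorem hasSum_coeff_formalLog_mul_pow {F G : ℚ_[p]⟦X⟧} (hF : IsPadicInt F)
    (hF0 : constantCoeff F = 1) (hG0 : constantCoeff G = 0)
    (hG : d⁄dX ℚ_[p] G * F = d⁄dX ℚ_[p] F) {u : ℚ_[p]} (hu : ‖u‖ < 1) :
    HasSum (fun n : ℕ => coeff n G * u ^ n) (padicLog p (padicEval F u)) := by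
  -- the Mercator series
  set Λ : ℚ_[p]⟦X⟧ := PowerSeries.mk fun k => if k = 0 then 0 else (-1) ^ (k + 1) / (k : ℚ_[p])
    with hΛdef
  have hΛ : ∀ k, coeff k Λ = if k = 0 then 0 else (-1) ^ (k + 1) / (k : ℚ_[p]) := fun k => by
    rw [hΛdef, coeff_mk]
  -- `A = F - 1`
  set A : ℚ_[p]⟦X⟧ := F - 1 with hAdef
  have hA : IsPadicInt A := hF.sub IsPadicInt.one
  have hA0 : constantCoeff A = 0 := by rw [hAdef, map_sub, hF0, map_one, sub_self]
  have hs : HasSubst A := HasSubst.of_constantCoeff_zero' hA0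
  have hFA : F = 1 + A := by rw [hAdef, add_sub_cancel]
  -- `Λ ∘ A = G`
  have hM : Λ.subst A = G := by
    refine derivative.ext ?_ ?_
    · -- derivatives: `(dΛ∘A)·dA·F = dA = dF = dG·F`
      have h1 : (d⁄dX ℚ_[p] Λ).subst A * F = 1 := by
        have h := congrArg (PowerSeries.subst A) (derivative_mercator_mul_one_add_X hΛ)
        rwa [subst_mul hs, subst_add hs, subst_X hs, one_subst_of_constantCoeff hA0, ← hFA] at h
      have hdA : d⁄dX ℚ_[p] A = d⁄dX ℚ_[p] F := by
        rw [hAdef, map_sub, show d⁄dX ℚ_[p] (1 : ℚ_[p]⟦X⟧) = 0 from (d⁄dX ℚ_[p]).map_one_eq_zero,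
          sub_zero]
      have hF' : F ≠ 0 := fun h => by
        have := congrArg constantCoeff h
        rw [hF0, map_zero] at this
        exact one_ne_zero this
      apply mul_right_cancel₀ hF'
      rw [derivative_subst ℚ_[p] hs, hG, mul_assoc, mul_comm (d⁄dX ℚ_[p] A) F, ← mul_assoc, h1, one_mul,
        hdA]
    · rw [constantCoeff_subst_of_constantCoeff Λ hA0, constantCoeff_mercator hΛ, hG0]
  -- numerics
  have hv : ‖padicEval A u‖ < 1 := norm_padicEval_lt_one hA hA0 hu
  have hFu : padicEval F u = 1 + padicEval A u := by
    rw [hFA, padicEval_add IsPadicInt.one hA hu, padicEval_one]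
  have h1 := hasSum_coeff_subst_mul_pow (norm_coeff_mercator_le hΛ) hA hA0 hu
  have h2 := hasSum_coeff_mercator_mul_pow hΛ hv
  have hval : padicEval Λ (padicEval A u) = padicLog p (1 + padicEval A u) := by
    have e : padicEval Λ (padicEval A u) = ∑' k : ℕ, coeff k Λ * (padicEval A u) ^ k := rfl
    rw [e, h2.tsum_eq]
  rw [hM, hval, ← hFu] at h1
  exact h1

/-- **`log_p (F(u)) = G(u)`** for `F ∈ 1 + Xℤ_p⟦X⟧`, `G` its formal logarithm (`G(0) = 0`,
`dG · F = dF`) and `‖u‖ < 1` (`padicEval G u` is the `tsum` `Σ' [Xⁿ]G uⁿ`, which converges by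
`hasSum_coeff_formalLog_mul_pow`). [cite: Iwasawa1972PadicL, §4.4] [cite: SilvermanAEC2009, IV.6.4] -/
theorem padicLog_padicEval {F G : ℚ_[p]⟦X⟧} (hF : IsPadicInt F) (hF0 : constantCoeff F = 1)
    (hG0 : constantCoeff G = 0) (hG : d⁄dX ℚ_[p] G * F = d⁄dX ℚ_[p] F) {u : ℚ_[p]}
    (hu : ‖u‖ < 1) : padicLog p (padicEval F u) = padicEval G u :=
  ((hasSum_coeff_formalLog_mul_pow hF hF0 hG0 hG hu).tsum_eq).symm

/-- **Log-derivative form**: if `F ∈ 1 + Xℤ_p⟦X⟧` and `G(0) = 0`, `dG = dF · F⁻¹`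
(`F⁻¹ = invOfUnit F 1`), then `Σ_n [Xⁿ]G uⁿ = log_p F(u)` for `‖u‖ < 1` — the shape of the tree's
`padicLogSigmaSqShift` (`[tⁿ]ℒ = n⁻¹ [tⁿ⁻¹](S′ S⁻¹)`). [cite: Iwasawa1972PadicL, §4.4]
[cite: SilvermanAEC2009, IV.6.4] -/
theorem hasSum_coeff_mul_pow_of_derivative_eq_mul_invOfUnit {F G : ℚ_[p]⟦X⟧} (hF : IsPadicInt F)
    (hF0 : constantCoeff F = 1) (hG0 : constantCoeff G = 0)
    (hG : d⁄dX ℚ_[p] G = d⁄dX ℚ_[p] F * F.invOfUnit 1) {u : ℚ_[p]} (hu : ‖u‖ < 1) :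
    HasSum (fun n : ℕ => coeff n G * u ^ n) (padicLog p (padicEval F u)) := by
  refine hasSum_coeff_formalLog_mul_pow hF hF0 hG0 ?_ hu
  have hinv : F * F.invOfUnit 1 = 1 := PowerSeries.mul_invOfUnit F 1 (by rw [hF0, Units.val_one])
  rw [hG, mul_assoc, mul_comm (F.invOfUnit 1) F, hinv, mul_one]

end LogOfEval

end Literature.NumberTheory.EllipticCurves
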